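import Mathlib
import Summits.KontsevichZagierPeriods.Zeta5Search.WedgeDictionary
import HarnessLib

/-!
# The wedge-square dictionary: kernel-checked instances of the `Q`-identity (`a = 1⁸` and `a = (2,1⁷)`)

Cell `pub-zeta5` (HONEST FRAMING: systematic search; no irrationality claim unless certified), typer seat
generation 3.  OUR work (Summit side).  The ζ-free conjunct of the conjecture `wedgeDictionary`
(`WedgeDictionary.lean`), `Q(a) = ρ(a)·(U(b)W(b′) − U(b′)W(b))`, is an identity of RATIONAL numbers; here it is
PROVED at the two smallest points of its region, with everything evaluated by the kernel / `norm_num`: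

* `a = 1⁸` (Brown–Zudilin's totally symmetric case, `n = 1`): `b = b(a) = (3; 1⁷)`, partner `b′ = (3; 2, 1⁶)`,
  `ρ = −1/8`, `(U, W) = (18, 66)`, `(U′, W′) = (−4, −24)`, and `Q(1⁸) = 21` (BZ §2: `Q₁ = 21`) `= ρ(UW′ − U′W)`;
* `a = (2, 1⁷)`: `b = (3; 0, 1⁶)`, partner `b′ = (3; 1⁷)`, `ρ = 2/3`, `(U, W) = (−8, −28)`, `Q = −16 = ρ(UW′ − U′W)`.

The canonical coefficients are obtained from EXPLICIT partial-fraction tables (`cSym`, `cSym1`, `cTwo`, integers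
here), each certified to be THE partial-fraction data of `R_b` (`IsPFData`, a rational-function identity checked
by `field_simp; ring`), so that `coeffU_eq`/`coeffW_eq` evaluate `U, W`.  These instances pin the conventions of
the typed conjecture (sign and indexing of `ρ`, `U ↔ c_{4,·}`, `W ↔ c_{2,·}`, `b(a)`, the partner shift) against
the 8550 exact instances computed by the planner seats (gen-1 `DICTIONARY.md`).  Values of this file were produced
by an independent script (`HOME/code/typer/pfdata.py`) and are re-verified here by Lean.
-/

noncomputable section

open Finset Polynomial

namespace Summit.KontsevichZagierPeriods.Zeta5Search.WedgeDictionary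

open Summit.KontsevichZagierPeriods.Zeta5Search.DualSeries
open Literature.NumberTheory.Irrationality.BrownZudilin2022 (bOfA QOf Converges)
open Literature.NumberTheory.Transcendental.BallRivoal (pfEval)

/-! ### The three dual parameter vectors -/

/-- `b = (3; 1,1,1,1,1,1,1) = b(1⁸)`. -/
def bSym : ℕ → ℤ := fun j => if j = 0 then 3 else if j ≤ 7 then 1 else 0

/-- `b′ = (3; 2,1,1,1,1,1,1) = b(1⁸) + e₁`. -/
def bSym1 : ℕ → ℤ := fun j => if j = 0 then 3 else if j = 1 then 2 else if j ≤ 7 then 1 else 0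

/-- `b = (3; 0,1,1,1,1,1,1) = b(2,1⁷)`. -/
def bTwo : ℕ → ℤ := fun j => if j = 0 then 3 else if j = 1 then 0 else if j ≤ 7 then 1 else 0

/-- `b(1⁸) = (3; 1⁷)`. -/
theorem bOfA_ones : bOfA ![1, 1, 1, 1, 1, 1, 1, 1] = bSym := by
  funext j
  match j with
  | 0 => rfl | 1 => rfl | 2 => rfl | 3 => rfl | 4 => rfl | 5 => rfl | 6 => rfl | 7 => rfl
  | n + 8 => simp [bOfA, bSym]

/-- `b(2,1⁷) = (3; 0, 1⁶)`. -/
theorem bOfA_two : bOfA ![2, 1, 1, 1, 1, 1, 1, 1] = bTwo := by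
  funext j
  match j with
  | 0 => rfl | 1 => rfl | 2 => rfl | 3 => rfl | 4 => rfl | 5 => rfl | 6 => rfl | 7 => rfl
  | n + 8 => simp [bOfA, bTwo]

/-- The partner shift `j = 1` of `(3; 1⁷)` is `(3; 2, 1⁶)`. -/
theorem update_bSym : Function.update bSym 1 (bSym 1 + 1) = bSym1 := by
  funext j
  by_cases hj : j = 1
  · subst hj; simp [bSym, bSym1]
  · rw [Function.update_of_ne hj]; simp [bSym, bSym1, hj]

/-- The partner shift `j = 1` of `(3; 0, 1⁶)` is `(3; 1⁷)`. -/
theorem update_bTwo : Function.update bTwo 1 (bTwo 1 + 1) = bSym := by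
  funext j
  by_cases hj : j = 1
  · subst hj; simp [bSym, bTwo]
  · rw [Function.update_of_ne hj]; simp [bSym, bTwo, hj]

/-! ### Explicit partial-fraction tables -/

/-- Partial-fraction data of `R_{(3;1⁷)}(t) = (2t+5)(t+1)(t+4)/((t+2)(t+3))^6`. -/
def cSym : ℕ → ℕ → ℚ := fun o p =>
  if o = 1 ∧ p = 1 then -33 else
  if o = 1 ∧ p = 2 then 33 else
  if o = 2 ∧ p = 1 then 33 else
  if o = 2 ∧ p = 2 then 33 else
  if o = 3 ∧ p = 1 then -21 else
  if o = 3 ∧ p = 2 then 21 else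
  if o = 4 ∧ p = 1 then 9 else
  if o = 4 ∧ p = 2 then 9 else
  if o = 5 ∧ p = 1 then -2 else
  if o = 5 ∧ p = 2 then 2 else
  0

/-- Partial-fraction data of `R_{(3;2,1⁶)}(t) = (2t+5)(t+1)(t+4)/((t+2)(t+3))^5`. -/
def cSym1 : ℕ → ℕ → ℚ := fun o p =>
  if o = 1 ∧ p = 1 then 12 else
  if o = 1 ∧ p = 2 then -12 else
  if o = 2 ∧ p = 1 then -12 else
  if o = 2 ∧ p = 2 then -12 else
  if o = 3 ∧ p = 1 then 7 else
  if o = 3 ∧ p = 2 then -7 else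
  if o = 4 ∧ p = 1 then -2 else
  if o = 4 ∧ p = 2 then -2 else
  0

/-- Partial-fraction data of `R_{(3;0,1⁶)}(t) = (2t+5)/((t+2)(t+3))^6`. -/
def cTwo : ℕ → ℕ → ℚ := fun o p =>
  if o = 1 ∧ p = 1 then 14 else
  if o = 1 ∧ p = 2 then -14 else
  if o = 2 ∧ p = 1 then -14 else
  if o = 2 ∧ p = 2 then -14 else
  if o = 3 ∧ p = 1 then 9 else
  if o = 3 ∧ p = 2 then -9 else
  if o = 4 ∧ p = 1 then -4 else
  if o = 4 ∧ p = 2 then -4 else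
  if o = 5 ∧ p = 1 then 1 else
  if o = 5 ∧ p = 2 then -1 else
  0

/-! ### The tables are THE partial-fraction data -/

/-- `(t+1)_4 = (t+1)(t+2)(t+3)(t+4)`. -/
theorem poch_four (t : ℚ) : Literature.NumberTheory.Transcendental.BallRivoal.poch (t + 1) 4 =
    (t + 1) * (t + 2) * (t + 3) * (t + 4) := by
  simp [Literature.NumberTheory.Transcendental.BallRivoal.poch, prod_range_succ]
  ring

/-- `numPoly_{(3;1⁷)}(t+1) = (2t+5)((t+1)(t+4))^7`. -/
theorem eval_numPoly_bSym (t : ℚ) :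
    ((numPoly bSym).comp (X + C 1)).eval t = (2 * t + 5) * ((t + 1) * (t + 4)) ^ 7 := by
  rw [eval_comp, eval_add, eval_X, eval_C, eval_numPoly]
  simp [bSym, prod_range_succ, Literature.NumberTheory.Transcendental.BallRivoal.poch]
  ring

/-- `numPoly_{(3;2,1⁶)}(t+1) = (2t+5)(t+1)(t+2)(t+3)(t+4)((t+1)(t+4))^6`. -/
theorem eval_numPoly_bSym1 (t : ℚ) :
    ((numPoly bSym1).comp (X + C 1)).eval t =
      (2 * t + 5) * ((t + 1) * (t + 2) * ((t + 3) * (t + 4))) * ((t + 1) * (t + 4)) ^ 6 := by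
  rw [eval_comp, eval_add, eval_X, eval_C, eval_numPoly]
  simp [bSym1, prod_range_succ, Literature.NumberTheory.Transcendental.BallRivoal.poch]
  ring

/-- `numPoly_{(3;0,1⁶)}(t+1) = (2t+5)((t+1)(t+4))^6`. -/
theorem eval_numPoly_bTwo (t : ℚ) :
    ((numPoly bTwo).comp (X + C 1)).eval t = (2 * t + 5) * ((t + 1) * (t + 4)) ^ 6 := by
  rw [eval_comp, eval_add, eval_X, eval_C, eval_numPoly]
  simp [bTwo, prod_range_succ, Literature.NumberTheory.Transcendental.BallRivoal.poch]
  ring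

/-- `cSym` is the partial-fraction data of `R_{(3;1⁷)}`. -/
theorem isPFData_bSym : IsPFData bSym cSym := by
  intro t ht
  have hB : (bSym 0).toNat = 3 := by decide
  rw [hB] at ht ⊢
  have h1 : t + 1 ≠ 0 := by have := ht 0 (by norm_num); simpa using this
  have h2 : t + 2 ≠ 0 := by have := ht 1 (by norm_num); intro h; apply this; push_cast; linarith
  have h3 : t + 3 ≠ 0 := by have := ht 2 (by norm_num); intro h; apply this; push_cast; linarith
  have h4 : t + 4 ≠ 0 := by have := ht 3 (by norm_num); intro h; apply this; push_cast; linarith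
  rw [eval_numPoly_bSym, poch_four]
  simp only [pfEval, sum_range_succ, sum_range_zero, cSym]
  norm_num
  rw [show t + 1 + 1 = t + 2 by ring, show t + 2 + 1 = t + 3 by ring]
  field_simp
  ring

/-- `cSym1` is the partial-fraction data of `R_{(3;2,1⁶)}`. -/
theorem isPFData_bSym1 : IsPFData bSym1 cSym1 := by
  intro t ht
  have hB : (bSym1 0).toNat = 3 := by decide
  rw [hB] at ht ⊢
  have h1 : t + 1 ≠ 0 := by have := ht 0 (by norm_num); simpa using this
  have h2 : t + 2 ≠ 0 := by have := ht 1 (by norm_num); intro h; apply this; push_cast; linarith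
  have h3 : t + 3 ≠ 0 := by have := ht 2 (by norm_num); intro h; apply this; push_cast; linarith
  have h4 : t + 4 ≠ 0 := by have := ht 3 (by norm_num); intro h; apply this; push_cast; linarith
  rw [eval_numPoly_bSym1, poch_four]
  simp only [pfEval, sum_range_succ, sum_range_zero, cSym1]
  norm_num
  rw [show t + 1 + 1 = t + 2 by ring, show t + 2 + 1 = t + 3 by ring]
  field_simp
  ring

/-- `cTwo` is the partial-fraction data of `R_{(3;0,1⁶)}`. -/
theorem isPFData_bTwo : IsPFData bTwo cTwo := by
  intro t ht
  have hB : (bTwo 0).toNat = 3 := by decide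
  rw [hB] at ht ⊢
  have h1 : t + 1 ≠ 0 := by have := ht 0 (by norm_num); simpa using this
  have h2 : t + 2 ≠ 0 := by have := ht 1 (by norm_num); intro h; apply this; push_cast; linarith
  have h3 : t + 3 ≠ 0 := by have := ht 2 (by norm_num); intro h; apply this; push_cast; linarith
  have h4 : t + 4 ≠ 0 := by have := ht 3 (by norm_num); intro h; apply this; push_cast; linarith
  rw [eval_numPoly_bTwo, poch_four]
  simp only [pfEval, sum_range_succ, sum_range_zero, cTwo]
  norm_num
  rw [show t + 1 + 1 = t + 2 by ring, show t + 2 + 1 = t + 3 by ring]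
  field_simp
  ring

/-! ### The canonical coefficients at the three vectors -/

/-- `U(3;1⁷) = 18`, `W(3;1⁷) = 66`. -/
theorem coeff_bSym : coeffU bSym = 18 ∧ coeffW bSym = 66 := by
  have hB : (bSym 0).toNat = 3 := by decide
  refine ⟨?_, ?_⟩
  · rw [coeffU_eq isPFData_bSym, hB]; simp only [sum_range_succ, sum_range_zero, cSym]; norm_num
  · rw [coeffW_eq isPFData_bSym, hB]; simp only [sum_range_succ, sum_range_zero, cSym]; norm_num

/-- `U(3;2,1⁶) = −4`, `W(3;2,1⁶) = −24`. -/
theorem coeff_bSym1 : coeffU bSym1 = -4 ∧ coeffW bSym1 = -24 := by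
  have hB : (bSym1 0).toNat = 3 := by decide
  refine ⟨?_, ?_⟩
  · rw [coeffU_eq isPFData_bSym1, hB]; simp only [sum_range_succ, sum_range_zero, cSym1]; norm_num
  · rw [coeffW_eq isPFData_bSym1, hB]; simp only [sum_range_succ, sum_range_zero, cSym1]; norm_num

/-- `U(3;0,1⁶) = −8`, `W(3;0,1⁶) = −28`. -/
theorem coeff_bTwo : coeffU bTwo = -8 ∧ coeffW bTwo = -28 := by
  have hB : (bTwo 0).toNat = 3 := by decide
  refine ⟨?_, ?_⟩
  · rw [coeffU_eq isPFData_bTwo, hB]; simp only [sum_range_succ, sum_range_zero, cTwo]; norm_num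
  · rw [coeffW_eq isPFData_bTwo, hB]; simp only [sum_range_succ, sum_range_zero, cTwo]; norm_num

/-! ### The two instances of the `Q`-identity -/

/-- `Q(1⁸) = 21` (Brown–Zudilin §2, `Q₁`), by the kernel from (17). -/
theorem QOf_ones : QOf ![1, 1, 1, 1, 1, 1, 1, 1] = 21 := by decide

/-- `Q(2,1⁷) = −16`, by the kernel from (17). -/
theorem QOf_two : QOf ![2, 1, 1, 1, 1, 1, 1, 1] = -16 := by decide

/-- `ρ(1⁸) = −1/8`. -/
theorem rhoOf_ones : rhoOf ![1, 1, 1, 1, 1, 1, 1, 1] = -1 / 8 := by decide +kernel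

/-- `ρ(2,1⁷) = 2/3`. -/
theorem rhoOf_two : rhoOf ![2, 1, 1, 1, 1, 1, 1, 1] = 2 / 3 := by decide +kernel

/-- **INSTANCE of the `Q`-identity of `wedgeDictionary` at `a = 1⁸`, partner `j = 1`** (the shape of its first
conjunct, literally): `Q(1⁸) = ρ(1⁸)·(U(b)W(b′) − U(b′)W(b))` with `b = b(1⁸)`, `b′ = b + e₁`; numerically
`21 = (−1/8)·(18·(−24) − (−4)·66)`. -/
theorem Q_identity_ones :
    let b := bOfA ![1, 1, 1, 1, 1, 1, 1, 1]
    let b' := Function.update b 1 (b 1 + 1)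
    (QOf ![1, 1, 1, 1, 1, 1, 1, 1] : ℚ) =
      rhoOf ![1, 1, 1, 1, 1, 1, 1, 1] * (coeffU b * coeffW b' - coeffU b' * coeffW b) := by
  simp only [bOfA_ones, update_bSym]
  rw [QOf_ones, rhoOf_ones, coeff_bSym.1, coeff_bSym.2, coeff_bSym1.1, coeff_bSym1.2]
  norm_num

/-- **INSTANCE of the `Q`-identity of `wedgeDictionary` at `a = (2,1⁷)`, partner `j = 1`**:
`Q(2,1⁷) = ρ·(U(b)W(b′) − U(b′)W(b))` with `b = (3;0,1⁶)`, `b′ = (3;1⁷)`; numerically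
`−16 = (2/3)·((−8)·66 − 18·(−28))`. -/
theorem Q_identity_two :
    let b := bOfA ![2, 1, 1, 1, 1, 1, 1, 1]
    let b' := Function.update b 1 (b 1 + 1)
    (QOf ![2, 1, 1, 1, 1, 1, 1, 1] : ℚ) =
      rhoOf ![2, 1, 1, 1, 1, 1, 1, 1] * (coeffU b * coeffW b' - coeffU b' * coeffW b) := by
  simp only [bOfA_two, update_bTwo]
  rw [QOf_two, rhoOf_two, coeff_bTwo.1, coeff_bTwo.2, coeff_bSym.1, coeff_bSym.2]
  norm_num

/-- Both points lie in the region of the conjecture (convergent, `0 ≤ 2b_i ≤ b₀+1`, `d ≥ 0`, `2(b₁+1) ≤ b₀+1`),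
decided by the kernel. -/
theorem region_ones_two :
    (Converges ![1, 1, 1, 1, 1, 1, 1, 1] ∧
      (∀ i ∈ Icc 1 7, 0 ≤ bOfA ![1, 1, 1, 1, 1, 1, 1, 1] i ∧
        2 * bOfA ![1, 1, 1, 1, 1, 1, 1, 1] i ≤ bOfA ![1, 1, 1, 1, 1, 1, 1, 1] 0 + 1) ∧
      0 ≤ dOf (bOfA ![1, 1, 1, 1, 1, 1, 1, 1]) ∧
      2 * (bOfA ![1, 1, 1, 1, 1, 1, 1, 1] 1 + 1) ≤ bOfA ![1, 1, 1, 1, 1, 1, 1, 1] 0 + 1) ∧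
    (Converges ![2, 1, 1, 1, 1, 1, 1, 1] ∧
      (∀ i ∈ Icc 1 7, 0 ≤ bOfA ![2, 1, 1, 1, 1, 1, 1, 1] i ∧
        2 * bOfA ![2, 1, 1, 1, 1, 1, 1, 1] i ≤ bOfA ![2, 1, 1, 1, 1, 1, 1, 1] 0 + 1) ∧
      0 ≤ dOf (bOfA ![2, 1, 1, 1, 1, 1, 1, 1]) ∧
      2 * (bOfA ![2, 1, 1, 1, 1, 1, 1, 1] 1 + 1) ≤ bOfA ![2, 1, 1, 1, 1, 1, 1, 1] 0 + 1) := by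
  refine ⟨⟨by decide, by decide, by decide, by decide⟩, ⟨by decide, by decide, by decide, by decide⟩⟩

end Summit.KontsevichZagierPeriods.Zeta5Search.WedgeDictionary
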